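import Literature.Computability.Complexity.MurrayWilliams2018SimulationMachine
import Literature.Computability.Complexity.MurrayWilliams2018EasyWitnessAssembly
import HarnessLib

/-!
# Murray–Williams 2018, Lemma 4.1: correctness of the simulation `N`, the hypothesis `hsim`
# from a generator of Umans' type, and the lemma from Theorem 3.1 + Umans

Literature / circuit complexity — derandomization. Sequel of
`MurrayWilliams2018SimulationMachine.lean` (the machine `N` and `MWSimN.simLang ∈ NTIME(tᵉ)`) and
of `MurrayWilliams2018EasyWitnessAssembly.lean` (Lemma 4.1 from `h31` and `hsim`). This file

* records **Umans' generator as data** (`UmansGenerator`: Murray–Williams 2018, Thm. 2.1/2.3 =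
  Umans 2003, Thm. 1, over the tree — `F ∈ FP` on `⟨⟨Y, 1ˢ⟩, seed⟩`, seeds of length
  `g (⌊log₂ |Y|⌋ + 1)`, `SIZE(s)`-pseudorandom (`IsSizePseudorandom`) whenever `1 ≤ s` and
  `sᵍ ≤ CC(Y)` (`stringCC`)); no instance is asserted (that is Umans' theorem, to be vendored or
  proved with its own provenance), the structure is the HYPOTHESIS of the theorems below;
* PROVES the correctness of `N` at the good lengths: `card_seeds_eq_accCount` (the machine's count
  IS the number of accepting seeds), `abs_accCount_sub_le` (the fooling step: Arthur's circuit of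
  size `≤ S`, `MATests.exists_circuit`, is fooled within `1/S` once `Sᵍ ≤ CC(y)`),
  `verdictBit_eq_false` / `verdictBit_eq_true` (soundness for every witness; completeness on the
  honest witness `⟨y₀, z₀⟩`, kept whole by the window);
* PROVES **`hsim_of_umansGenerator`** — the hypothesis `hsim` of
  `MurrayWilliams2018_lemma_4_1_ae_of_ingredients` verbatim, for every referee `Ref ∈ P`, from a
  `G : UmansGenerator`: `k = k_t + (A+1)·g` (`k_t` the time degree of the machine, `A + 1` the
  degree dominating Arthur's circuits, `exists_exp_dominating`), `c₀ = 7` (the advice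
  `⟨⟨x_h, adv ℓ⟩, 1…1⟩` padded to `7(a+1)ℓ`), the good lengths from `|adv ℓ| ≤ a ℓ`, `ℓ ≥ 7` and
  `ℓ ≥ A(2a+10)^A + A`;
* and concludes **`MurrayWilliams2018_lemma_4_1_ae_of_thm31_of_umansGenerator`** (from the
  specialised `h31`) and **`MurrayWilliams2018_lemma_4_1_ae_of_thm_3_1_universal_of_umansGenerator`**
  (from Theorem 3.1 in universal-referee form with general `s₁, s₂`): Lemma 4.1 (a.e. form) from
  Theorem 3.1 and a generator of Umans' type.

After this file the trust base of `MurrayWilliams2018_lemma_4_1_ae` along the source's own proof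
line is exactly {Theorem 3.1 (universal-referee form), Umans 2003 Thm. 1 (as `UmansGenerator`)}.
Nothing is asserted; no named fact is introduced (D-0026). (The correctness theorems parallel
those of `MurrayWilliams2018Simulation.lean` for the abstract-interface behaviour `MWSim.verdictBit`;
here they are proved for the machine's own `MWSimN.verdictBit`, whose parameters are computed by
the `TM2` verifier of `MurrayWilliams2018SimulationMachine.lean`, and closed up into `hsim`.)

## References

* C. D. Murray, R. R. Williams, *Circuit lower bounds for nondeterministic quasi-polytime: an easy
  witness lemma for NP and NQP*, STOC 2018 = SIAM J. Comput. 49(5) (2020), Thm. 2.3 (Umans'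
  generator), proof of Lemma 4.1 (SIAM pp. 315–316) [MurrayWilliams2018].
* C. Umans, *Pseudo-random generators for all hardnesses*, J. Comput. Syst. Sci. 67 (2003)
  419–440, Thm. 1 (cited through MW Thm. 2.3).
* S. Arora, B. Barak, *Computational Complexity: A Modern Approach*, CUP 2009, proof of
  Lemma 20.3 [AroraBarakCC2009].
-/

noncomputable section

namespace Literature.Computability.Complexity

open _root_.Computability Turing Finset Filter Polynomial Brick Plumb

/-! ### Umans' generator (MW Thm. 2.1 / 2.3), as data -/

/-- **A generator of Umans' type** (Murray–Williams 2018, Thm. 2.3 = Umans 2003: "There is a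
universal constant `g` and a function `G : {0,1}* × {0,1}* → {0,1}*` such that, for all `s` and `Y`
satisfying `CC(Y) ≥ sᵍ`, and for all circuits `C` of size `s`,
`|Pr_{x ∈ {0,1}^{g log |Y|}}[C(G(Y, x)) = 1] − Pr_{x ∈ {0,1}ˢ}[C(x) = 1]| < 1/s`. Furthermore, `G` is
computable in `poly(|Y|)` time."), over the tree: a string function `F ∈ FP` read on
`⟨⟨Y, 1ˢ⟩, seed⟩` (the target size `s` is an explicit argument — the construction depends on it —
in unary, so that "poly(|Y|) time" for `s ≤ |Y|` is polynomial time in the input), seeds of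
length `g (⌊log₂ |Y|⌋ + 1)`, the first `s` output bits read as a generator
`{0,1}^{g(⌊log₂|Y|⌋+1)} → {0,1}ˢ` (`gen`), which is `SIZE(s)`-pseudorandom (`IsSizePseudorandom`:
fools every `B₂`-circuit of size `≤ s` on `s` inputs with error `≤ 1/s`, the non-strict form of
the tree) whenever `1 ≤ s` and `sᵍ ≤ CC(Y)` (`stringCC`, `MurrayWilliams2018StringComplexity.lean`).
[cite: MurrayWilliams2018, Thm. 2.1] -/
structure UmansGenerator where
  /-- the generator as a string function on `⟨⟨Y, 1ˢ⟩, seed⟩` -/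
  F : List Bool → List Bool
  /-- the seed-length constant -/
  g : ℕ
  /-- polynomial time -/
  F_mem_FP : F ∈ FP
  /-- `g ≥ 1` -/
  one_le_g : 1 ≤ g
  /-- pseudorandomness from hard strings, at every target size -/
  fools : ∀ (Y : List Bool) (s : ℕ), 1 ≤ s → s ^ g ≤ stringCC Y →
    IsSizePseudorandom (fun (seed : Fin (g * (Nat.log 2 Y.length + 1)) → Bool) (i : Fin s) =>
      (F (boolPair (boolPair Y (ones s)) (List.ofFn seed))).getD i false)

/-- The generator family of a string function `F` at seed constant `g`: on the string `Y` and target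
size `s`, seed `↦` the first `s` bits of `F ⟨⟨Y, 1ˢ⟩, seed⟩`. [cite: MurrayWilliams2018, Thm. 2.1] -/
def umansGen (F : List Bool → List Bool) (g : ℕ) (Y : List Bool) (s : ℕ) :
    (Fin (g * (Nat.log 2 Y.length + 1)) → Bool) → (Fin s → Bool) :=
  fun seed i => (F (boolPair (boolPair Y (ones s)) (List.ofFn seed))).getD i false

namespace MWSimN

/-! ### Correctness of the simulation at the good lengths -/

section Correct

variable (Ref : Language Bool) (F : List Bool → List Bool) (g k₁ : ℕ)

/-- **The pseudorandom acceptance count**: for Arthur's circuit `C` at `(⟨x, α⟩, z)` on `S` inputs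
(reading the first `|U| = m ℓ`), the seeds on which `C` accepts the generator's output are counted by
`accCount`. [folklore] -/
theorem card_seeds_eq_accCount (x α z U y : List Bool) {S : ℕ} (hmS : U.length ≤ S)
    (hS : S = sizeParam k₁ x U) (C : Circuit (Fin S))
    (hC : ∀ r, C.eval r = Ref.boolIndicator (boolPair (boolPair x α)
      (encMoves [z, List.ofFn fun i : Fin U.length => r (Fin.castLE hmS i)]))) :
    #{seed : Fin (seedLen g y) → Bool | C.eval (umansGen F g y S seed) = true} =
      accCount Ref F g k₁ x α z U y := by
  classical
  subst hS
  set E : Set (List Bool) := {σ | boolPair (boolPair x α) (encMoves [z, List.takeD U.length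
    (F (boolPair (boolPair y (ones (sizeParam k₁ x U))) σ)) false]) ∈ Ref} with hE
  have h1 : accCount Ref F g k₁ x α z U y = cnt (seedLen g y) E := by
    rw [accCount, ← CoinEnum.sum_range_ite_natBits]
    refine Finset.sum_congr rfl fun i hi => ?_
    rw [PRGDerand.takeD_encodeNat_eq_natBits (Finset.mem_range.1 hi)]
    by_cases h : natBits (seedLen g y) i ∈ E
    · rw [if_pos h, (Set.mem_iff_boolIndicator _ _).1 (show _ ∈ Ref from h)]; rfl
    · rw [if_neg h, (Set.notMem_iff_boolIndicator _ _).1 (show _ ∉ Ref from h)]; rfl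
  rw [h1, ← card_filter_ofFn_mem_eq_cnt]
  refine congrArg Finset.card (Finset.filter_congr fun seed _ => ?_)
  rw [hC, ← Set.mem_iff_boolIndicator]
  have e : (List.ofFn fun i : Fin U.length => umansGen F g y (sizeParam k₁ x U) seed (Fin.castLE hmS i)) =
      List.takeD U.length (F (boolPair (boolPair y (ones (sizeParam k₁ x U))) (List.ofFn seed))) false := by
    rw [← ofFn_getD_eq_takeD]
    simp [umansGen]
  rw [e]
  rfl

variable {Ref F g}

/-- **The fooling step**: if the target size `S = (ℓ + m ℓ)^{k₁}` is at least `1` and `Sᵍ ≤ CC(y)`,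
then for Arthur's circuit of size `≤ S` the seed count of any message `z` agrees with Arthur's
acceptance probability within `1/S`. [cite: MurrayWilliams2018, Lemma 4.1 (proof)] -/
theorem abs_accCount_sub_le (G : UmansGenerator) (x α z U y : List Bool) {S : ℕ}
    (hmS : U.length ≤ S) (hS : S = sizeParam k₁ x U) (h1 : 1 ≤ S) (hhard : S ^ G.g ≤ stringCC y)
    (C : Circuit (Fin S)) (hB : C.IsOver B2) (hs : C.size ≤ S)
    (hC : ∀ r, C.eval r = Ref.boolIndicator (boolPair (boolPair x α)
      (encMoves [z, List.ofFn fun i : Fin U.length => r (Fin.castLE hmS i)]))) :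
    |(accCount Ref G.F G.g k₁ x α z U y : ℝ) / 2 ^ seedLen G.g y -
        uniformProb U.length {c | boolPair (boolPair x α) (encMoves [z, c]) ∈ Ref}| ≤
      1 / ((S : ℕ) : ℝ) := by
  have hadv := G.fools y S h1 hhard C hB hs
  unfold MetaComplexity.prgAdvantage at hadv
  rw [show (fun (seed : Fin (G.g * (Nat.log 2 y.length + 1)) → Bool) (i : Fin S) =>
      (G.F (boolPair (boolPair y (ones S)) (List.ofFn seed))).getD i false) = umansGen G.F G.g y S from rfl,
    card_seeds_eq_accCount Ref G.F G.g k₁ x α z U y hmS hS C hC,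
    MATests.card_random_eq_uniformProb Ref (boolPair x α) z hmS C hC] at hadv
  exact hadv

end Correct

/-! ### Soundness and completeness at the good lengths -/

section SoundComplete

variable {Ref : Language Bool} (G : UmansGenerator) (k₁ : ℕ) (t m : ℕ → ℕ) {L : Language Bool}
  (V : NVerifier t L)

/-- A verifier's constant is positive (no machine outputs anything within `0` steps). [folklore] -/
theorem _root_.Literature.Computability.Complexity.NVerifier.one_le_c {t : ℕ → ℕ} {L : Language Bool}
    (V : NVerifier t L) : 1 ≤ V.c := by
  by_contra h
  have h0 : V.c = 0 := by omega
  have := V.outputsWithin [] [] (by simp)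
  rw [h0, zero_mul, zero_add] at this
  exact not_outputsWithin_zero V.machine _ _ this

/-- The honest witness `⟨y₀, z₀⟩` (an admissible witness of `V` and a message of the move length)
fits in the window. [folklore] -/
theorem length_honest_le_window (x xh α junk y₀ z₀ : List Bool)
    (hy₀ : y₀.length ≤ V.c * t xh.length + V.c) (hz₀ : z₀.length = m x.length) :
    (boolPair y₀ z₀).length ≤ window t m V.c (boolPair x (boolPair (boolPair xh α) junk)) := by
  simp only [window, wlen, xhIn_boolPair, xIn_boolPair, length_boolPair]
  omega

/-- **Soundness at a good length**: if every message of Merlin on `⟨x, α⟩` is accepted with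
probability `≤ 1/3`, and every admissible accepted witness of the bad input `x_h` is hard for the
target size `S = (ℓ + m ℓ)^{k₁}` (`Sᵍ ≤ CC(y)`), which also dominates Arthur's circuits, then the
simulating verifier rejects EVERY witness on `⟨x, ⟨⟨x_h, α⟩, junk⟩⟩`.
[cite: MurrayWilliams2018, Lemma 4.1 (proof)] -/
theorem verdictBit_eq_false {q : Polynomial ℕ}
    (hq : ∀ (x y : List Bool) (m' N' : ℕ) (hmN : m' ≤ N'),
      ∃ C : Circuit (Fin N'), C.IsOver B2 ∧ C.size ≤ q.eval (2 * x.length + y.length + m') ∧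
        ∀ r, C.eval r = Ref.boolIndicator
          (boolPair x (encMoves [y, List.ofFn fun i : Fin m' => r (Fin.castLE hmN i)])))
    (x xh α junk : List Bool)
    (h7 : 7 ≤ sizeParam k₁ x (ones (m x.length)))
    (hmS : m x.length ≤ sizeParam k₁ x (ones (m x.length)))
    (hqS : q.eval (2 * (boolPair x α).length + m x.length + m x.length) ≤
      sizeParam k₁ x (ones (m x.length)))
    (hhard : ∀ y : List Bool, y.length ≤ V.c * t xh.length + V.c → V.rel xh y = true →
      sizeParam k₁ x (ones (m x.length)) ^ G.g ≤ stringCC y)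
    (hrej : ∀ z : List.Vector Bool (m x.length),
      uniformProb (m x.length) {c | boolPair (boolPair x α) (encMoves [z.toList, c]) ∈ Ref} ≤ 1 / 3)
    (zp : List Bool) :
    verdictBit Ref G.F G.g k₁ t m V (boolPair x (boolPair (boolPair xh α) junk)) zp = false := by
  set S := sizeParam k₁ x (ones (m x.length)) with hS
  rw [verdictBit]
  simp only [xhIn_boolPair, xIn_boolPair, alphaIn_boolPair, wlen]
  set y := (fstF zp).take (V.c * t xh.length + V.c) with hy
  set z := List.takeD (m x.length) (sndF zp) false with hz
  cases hrel : V.rel xh y with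
  | false => rfl
  | true =>
    rw [Bool.true_and, decide_eq_false_iff_not, not_lt]
    have hylen : y.length ≤ V.c * t xh.length + V.c := by rw [hy]; exact List.length_take_le _ _
    have hzlen : z.length = m x.length := by rw [hz]; exact List.takeD_length _ _ _
    have hU : (ones (m x.length)).length = m x.length := List.length_replicate
    have hmS' : (ones (m x.length)).length ≤ S := by rw [hU]; exact hmS
    obtain ⟨C, hB, hs, hC⟩ := hq (boolPair x α) z (ones (m x.length)).length S hmS'
    have hsz : C.size ≤ S := hs.trans (by rw [hzlen, hU]; exact hqS)
    have h1 : 1 ≤ S := by omega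
    have habs := abs_accCount_sub_le (k₁ := k₁) G x α z (ones (m x.length)) y hmS' rfl h1
      (hhard y hylen hrel) C hB hsz hC
    rw [hU] at habs
    have hPr := hrej ⟨z, hzlen⟩
    simp only [List.Vector.toList_mk] at hPr
    have hlt : (accCount Ref G.F G.g k₁ x α z (ones (m x.length)) y : ℝ) / 2 ^ seedLen G.g y < 1 / 2 :=
      lt_half_of_abs_sub_le habs hPr (one_div_lt_one_sixth h7)
    by_contra hle
    rw [not_le, two_pow_lt_two_mul_iff] at hle
    linarith

/-- **Completeness at a good length**: an admissible accepted witness `y₀` of the bad input and a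
message `z₀` of Merlin accepted with probability `≥ 2/3` make the simulating verifier accept on the
honest witness `⟨y₀, z₀⟩` (kept whole by the window). [cite: MurrayWilliams2018, Lemma 4.1 (proof)] -/
theorem verdictBit_eq_true {q : Polynomial ℕ}
    (hq : ∀ (x y : List Bool) (m' N' : ℕ) (hmN : m' ≤ N'),
      ∃ C : Circuit (Fin N'), C.IsOver B2 ∧ C.size ≤ q.eval (2 * x.length + y.length + m') ∧
        ∀ r, C.eval r = Ref.boolIndicator
          (boolPair x (encMoves [y, List.ofFn fun i : Fin m' => r (Fin.castLE hmN i)])))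
    (x xh α junk : List Bool)
    (h7 : 7 ≤ sizeParam k₁ x (ones (m x.length)))
    (hmS : m x.length ≤ sizeParam k₁ x (ones (m x.length)))
    (hqS : q.eval (2 * (boolPair x α).length + m x.length + m x.length) ≤
      sizeParam k₁ x (ones (m x.length)))
    (hhard : ∀ y : List Bool, y.length ≤ V.c * t xh.length + V.c → V.rel xh y = true →
      sizeParam k₁ x (ones (m x.length)) ^ G.g ≤ stringCC y)
    (y₀ : List Bool) (hy₀ : y₀.length ≤ V.c * t xh.length + V.c) (hacc : V.rel xh y₀ = true)
    (z₀ : List.Vector Bool (m x.length))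
    (hPr : 2 / 3 ≤ uniformProb (m x.length) {c | boolPair (boolPair x α) (encMoves [z₀.toList, c]) ∈ Ref}) :
    verdictBit Ref G.F G.g k₁ t m V (boolPair x (boolPair (boolPair xh α) junk)) (boolPair y₀ z₀.toList) = true := by
  set S := sizeParam k₁ x (ones (m x.length)) with hS
  rw [verdictBit]
  simp only [xhIn_boolPair, xIn_boolPair, alphaIn_boolPair, wlen, fstF_boolPair, sndF_boolPair]
  have hy : y₀.take (V.c * t xh.length + V.c) = y₀ := List.take_of_length_le hy₀
  have hz : List.takeD (m x.length) z₀.toList false = z₀.toList := by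
    rw [List.takeD_eq_take _ (by simp), List.take_of_length_le (by simp)]
  rw [hy, hz, hacc, Bool.true_and, decide_eq_true_eq]
  have hU : (ones (m x.length)).length = m x.length := List.length_replicate
  have hmS' : (ones (m x.length)).length ≤ S := by rw [hU]; exact hmS
  obtain ⟨C, hB, hs, hC⟩ := hq (boolPair x α) z₀.toList (ones (m x.length)).length S hmS'
  have hsz : C.size ≤ S := hs.trans (by rw [List.Vector.toList_length, hU]; exact hqS)
  have h1 : 1 ≤ S := by omega
  have habs := abs_accCount_sub_le (k₁ := k₁) G x α z₀.toList (ones (m x.length)) y₀ hmS' rfl h1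
    (hhard y₀ hy₀ hacc) C hB hsz hC
  rw [hU] at habs
  have hgt : (1 : ℝ) / 2 < (accCount Ref G.F G.g k₁ x α z₀.toList (ones (m x.length)) y₀ : ℝ) /
      2 ^ seedLen G.g y₀ :=
    half_lt_of_abs_sub_le habs hPr (one_div_lt_one_sixth h7)
  rwa [two_pow_lt_two_mul_iff]

end SoundComplete

/-! ### The derandomised advice simulation (hypothesis `hsim` of the assembly) -/

section HSim

/-- A polynomial is eventually dominated by the next power, uniformly in a linear rescaling:
for `q` there is `A` such that `q (B u) ≤ u^{A+1}` whenever `u ≥ A · B^A + A` (`B, u ≥ 1`). [folklore] -/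
theorem exists_exp_dominating (q : Polynomial ℕ) : ∃ A : ℕ, ∀ B u : ℕ, 1 ≤ B → 1 ≤ u →
    A * B ^ A + A ≤ u → q.eval (B * u) ≤ u ^ (A + 1) := by
  obtain ⟨A, hA⟩ := EasyWitness.exists_const_eval_le q
  refine ⟨A, fun B u hB hupos hu => ?_⟩
  have h1 : 1 ≤ B * u := Nat.mul_pos hB hupos
  calc q.eval (B * u) ≤ A * (B * u) ^ A + A := hA _ h1
    _ = A * B ^ A * u ^ A + A := by rw [mul_pow, mul_assoc]
    _ ≤ A * B ^ A * u ^ A + A * u ^ A :=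
        Nat.add_le_add_left (Nat.le_mul_of_pos_right _ (Nat.pow_pos hupos)) _
    _ = (A * B ^ A + A) * u ^ A := by ring
    _ ≤ u * u ^ A := Nat.mul_le_mul_right _ hu
    _ = u ^ (A + 1) := by ring

/-- **The derandomised advice simulation from a generator of Umans' type** — hypothesis `hsim` of
`MurrayWilliams2018_lemma_4_1_ae_of_ingredients` (Murray–Williams 2018, proof of Lemma 4.1:
"We give a nondeterministic algorithm `N` such that for all `i` and all inputs of length `nᵢ`, `N`
uses `(2d′+1)nᵢ` bits of advice, runs in `O(t(nᵢ)ᵉ)` time, and correctly decides `L₁` on all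
`nᵢ`-bit inputs … On inputs of length `s′₂(nᵢ)`, the advice to `N` is `x_hard` as well as the advice
`α_{s′₂(nᵢ)}`"). For every referee `Ref ∈ P`: exponents `k` (the running-time degree of the
machine together with `g · k₁`, `k₁` the degree dominating Arthur's circuits) and `c₀ = 7`; for all
time-constructible monotone `t`, time-constructible `m ≤ t` (a.e.), advice rate `a`, verifier `V`,
hardness `w`, advice `adv` (linear a.e.) and advised game `L₁`, the pair language
`MWSimN.simLang Ref F g k₁ t m V` is in `NTIME(tᵉ)` for all `e ≥ k` and decides `L₁` on `{0,1}^ℓ` with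
the advice `⟨⟨x_h, adv ℓ⟩, 1…1⟩` of length `7(a+1)ℓ`, for all large `n`, all bad `x_h ∈ L` of length
`n` and all `ℓ ≥ n` with `(ℓ + m ℓ)ᵏ ≤ w n`. [cite: MurrayWilliams2018, Lemma 4.1 (proof)] -/
theorem hsim_of_umansGenerator (G : UmansGenerator) (Ref : Language Bool) (hRef : Ref ∈ Classes.P) :
    ∃ k c₀ : ℕ, 1 ≤ k ∧
      ∀ (t m : ℕ → ℕ) (a : ℕ), IsTimeConstructible t → Monotone t → IsTimeConstructible m →
        (∀ᶠ n in atTop, m n ≤ t n) →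
        ∀ {L : Language Bool} (V : NVerifier t L) (w : ℕ → ℕ) (adv : ℕ → List Bool)
          (L₁ : Language Bool),
          (∀ᶠ n in atTop, (adv n).length ≤ a * n) → AdvisedMAGame Ref m adv L₁ →
          ∃ N' : Language Bool, (∀ e : ℕ, k ≤ e → N' ∈ NTIME (fun n => t n ^ e)) ∧
            ∀ᶠ n in atTop, ∀ xh : List Bool, xh ∈ L → xh.length = n →
              (∀ y : List Bool, y.length ≤ V.c * t xh.length + V.c → V.rel xh y = true →
                w xh.length < stringCC y) →
              ∀ ℓ : ℕ, n ≤ ℓ → (ℓ + m ℓ) ^ k ≤ w n → DecidesOnWithAdvice N' (c₀ * (a + 1)) L₁ ℓ := by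
  obtain ⟨q, hq⟩ := MATests.exists_circuit hRef
  obtain ⟨A, hA⟩ := exists_exp_dominating q
  obtain ⟨kt, hkt1, hkt⟩ := exists_simLang_mem_NTIME G.g (A + 1) hRef G.F_mem_FP
  refine ⟨kt + (A + 1) * G.g, 7, by omega, fun t m a ht htmono hm hmt L V w adv L₁ hadv hgame => ?_⟩
  refine ⟨simLang Ref G.F G.g (A + 1) t m V,
    fun e he => hkt t m V ht htmono hm hmt V.one_le_c e (by omega), ?_⟩
  obtain ⟨ℓa, hℓa⟩ := eventually_atTop.1 hadv
  refine eventually_atTop.2 ⟨max (max ℓa 7) (A * (2 * a + 10) ^ A + A), fun n hn xh hxL hxn hbad ℓ hnℓ hguard => ?_⟩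
  have hℓa' : (adv ℓ).length ≤ a * ℓ := hℓa ℓ (by omega)
  have hℓ7 : 7 ≤ ℓ := by omega
  have hℓA : A * (2 * a + 10) ^ A + A ≤ ℓ := by omega
  -- the advice, padded to exactly `7 (a + 1) ℓ`
  set α := adv ℓ with hα
  set pad : ℕ := 7 * (a + 1) * ℓ - (2 * (2 * n + 2 + α.length) + 2) with hpad
  set β := boolPair (boolPair xh α) (List.replicate pad true) with hβ
  have hβlen : β.length = 7 * (a + 1) * ℓ := by
    rw [hβ, length_boolPair, length_boolPair, List.length_replicate, hxn, hpad]
    have : 2 * (2 * n + 2 + α.length) + 2 ≤ 7 * (a + 1) * ℓ := by nlinarith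
    omega
  refine ⟨β, hβlen, fun x hx => ?_⟩
  -- the guards at `(n, ℓ)`
  set S := sizeParam (A + 1) x (ones (m x.length)) with hS
  have hSu : S = (ℓ + m ℓ) ^ (A + 1) := by
    rw [hS, sizeParam, hx]; simp [ones]
  have hu1 : 1 ≤ ℓ + m ℓ := by omega
  have hSge : ℓ + m ℓ ≤ S := by rw [hSu]; exact Nat.le_self_pow (by omega) _
  have h7 : 7 ≤ S := by omega
  have hmS : m x.length ≤ S := by rw [hx]; omega
  have hqS : q.eval (2 * (boolPair x α).length + m x.length + m x.length) ≤ S := by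
    rw [length_boolPair, hx, hSu]
    have harg : 2 * (2 * ℓ + 2 + α.length) + m ℓ + m ℓ ≤ (2 * a + 10) * (ℓ + m ℓ) := by nlinarith
    exact (TM2Iter.eval_mono q harg).trans
      (hA (2 * a + 10) (ℓ + m ℓ) (by omega) hu1 (hℓA.trans (by omega)))
  have hhard : ∀ y : List Bool, y.length ≤ V.c * t xh.length + V.c → V.rel xh y = true →
      S ^ G.g ≤ stringCC y := by
    intro y hy hrel
    have h1 := hbad y hy hrel
    rw [hxn] at h1
    have h2 : S ^ G.g ≤ (ℓ + m ℓ) ^ (kt + (A + 1) * G.g) := by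
      rw [hSu, ← pow_mul]
      exact Nat.pow_le_pow_right hu1 (by omega)
    exact (h2.trans hguard).trans h1.le
  constructor
  · -- completeness
    intro hxL₁
    have hval := (hgame x).1 hxL₁
    rw [hx] at hval
    obtain ⟨z₀, hz₀⟩ := exists_le_uniformProb_of_le_amValue hval
    obtain ⟨y₀, hy₀, hacc⟩ := (V.mem_iff xh).1 hxL
    refine ⟨boolPair y₀ z₀.toList, ?_, ?_⟩
    · rw [hβ]
      exact length_honest_le_window t m V x xh α _ y₀ z₀.toList hy₀ (by rw [List.Vector.toList_length, hx])
    · rw [hβ]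
      have hz₀' : 2 / 3 ≤ uniformProb (m x.length)
          {c | boolPair (boolPair x α) (encMoves [z₀.toList, c]) ∈ Ref} := by rw [hx]; exact hz₀
      have := verdictBit_eq_true G (A + 1) t m V hq x xh α (List.replicate pad true) h7 hmS hqS hhard
        y₀ hy₀ hacc (hx ▸ z₀) ?_
      · convert this using 3
        all_goals first | rfl | (subst hx; rfl)
      · subst hx; exact hz₀
  · -- soundness
    rintro ⟨zp, -, hzp⟩
    by_contra hxL₁
    have hval := (hgame x).2 hxL₁
    rw [hx] at hval
    have hrej : ∀ z : List.Vector Bool (m x.length),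
        uniformProb (m x.length) {c | boolPair (boolPair x α) (encMoves [z.toList, c]) ∈ Ref} ≤ 1 / 3 := by
      rw [hx]; exact fun z => forall_uniformProb_le_of_amValue_le hval z
    have := verdictBit_eq_false G (A + 1) t m V hq x xh α (List.replicate pad true) h7 hmS hqS hhard hrej zp
    rw [hβ] at hzp
    rw [this] at hzp
    exact Bool.false_ne_true hzp

end HSim

end MWSimN

/-- **Murray–Williams 2018, Lemma 4.1 (a.e. form) from Theorem 3.1 and a generator of Umans'
type**: the assembly `MurrayWilliams2018_lemma_4_1_ae_of_ingredients` with its hypothesis `hsim`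
discharged by `MWSimN.hsim_of_umansGenerator`. The remaining hypothesis `h31` is Theorem 3.1 in
universal-referee form, specialised to `s₂ = s^{D'}`, `s₁ = (s ∘ s₂)^D` (module docstring of
`MurrayWilliams2018EasyWitnessAssembly.lean`). [cite: MurrayWilliams2018, Lemma 4.1] -/
theorem MurrayWilliams2018_lemma_4_1_ae_of_thm31_of_umansGenerator
    (h31 : ∃ Ref : Language Bool, Ref ∈ Classes.P ∧ ∃ D : ℕ, 1 ≤ D ∧
      ∀ (s : ℕ → ℕ) (D' : ℕ), D * D + D + 2 ≤ D' → StrictMono s → IsTimeConstructible s →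
        (∀ᶠ n in atTop, n * s n ^ 2 < 2 ^ n) →
        ∃ (adv : ℕ → List Bool) (L₁ : Language Bool),
          (∀ n, (adv n).length ≤ D * (Nat.log 2 (s n ^ D') + 1)) ∧
          AdvisedMAGame Ref (mwMoveLen s D D') adv L₁ ∧
          ∀ᶠ n in atTop, s n < L₁.circuitSize n ∨ s (s n ^ D') < L₁.circuitSize (s n ^ D'))
    (G : UmansGenerator) : MurrayWilliams2018_lemma_4_1_ae :=
  MurrayWilliams2018_lemma_4_1_ae_of_ingredients h31 fun Ref hRef =>
    MWSimN.hsim_of_umansGenerator G Ref hRef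

/-- **Murray–Williams 2018, Lemma 4.1 (a.e. form) from Theorem 3.1 (universal-referee form,
general `s₁, s₂` under eventual generous constraints (i)–(iii)) and a generator of Umans' type.**
[cite: MurrayWilliams2018, Lemma 4.1] -/
theorem MurrayWilliams2018_lemma_4_1_ae_of_thm_3_1_universal_of_umansGenerator
    (h31 : ∃ Ref : Language Bool, Ref ∈ Classes.P ∧ ∃ D : ℕ, 1 ≤ D ∧
      ∀ (s s₁ s₂ : ℕ → ℕ), StrictMono s → IsTimeConstructible s →
        (∀ᶠ n in atTop, n * s n ^ 2 < 2 ^ n) →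
        IsTimeConstructible s₁ → IsTimeConstructible s₂ →
        (∀ᶠ n in atTop, (n + s n + 2) ^ D ≤ s₂ n) → (∀ᶠ n in atTop, s (s₂ n) ^ D ≤ s₁ n) →
        (∀ᶠ n in atTop, (n + s n + 2) ^ D ≤ s₁ n) →
        ∃ (adv : ℕ → List Bool) (L₁ : Language Bool),
          (∀ n, (adv n).length ≤ D * (Nat.log 2 (s₂ n) + 1)) ∧
          AdvisedMAGame Ref (fun n => (s₁ n * s₂ n) ^ D) adv L₁ ∧
          ∀ᶠ n in atTop, s n < L₁.circuitSize n ∨ s (s₂ n) < L₁.circuitSize (s₂ n))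
    (G : UmansGenerator) : MurrayWilliams2018_lemma_4_1_ae :=
  MurrayWilliams2018_lemma_4_1_ae_of_ingredients (h31_of_thm_3_1_universal h31) fun Ref hRef =>
    MWSimN.hsim_of_umansGenerator G Ref hRef

end Literature.Computability.Complexity

end
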